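import Summits.KontsevichZagierPeriods.KontsevichZagierPeriods.Theses.CubicTransport
import Summits.KontsevichZagierPeriods.KontsevichZagierPeriods.Theses.MellinCoarea
import Summits.KontsevichZagierPeriods.KontsevichZagierPeriods.Theses.TwoRouteTransport
import Summits.KontsevichZagierPeriods.KontsevichZagierPeriods.Theorems.InverseLandauTateLiftingDuplicationFamily

/-!
# `DuplicationFamily` (stmt-KontsevichZagierPeriods-3727; routes CubicTransport / MellinCoarea /
# TwoRouteTransport) — the three verbatim twins

Legendre's duplication formula `B(a,a) = 2^{1−2a} B(1/2,a)` INSIDE the Kontsevich–Zagier rules: for every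
rational `a > 0`, any two integral representations `[(0,1), (x(1−x))^{a−1}]` and
`[(0,1), 2^{1−2a} x^{−1/2}(1−x)^{a−1}]` on `ℝ¹` (pinned by domain and integrand) are KZ-equivalent. This
is verbatim `InverseLandau.tateLifting_duplicationFamily` (line `Sketch` of the crux `TateLifting`,
stmt-KontsevichZagierPeriods-9129, lead c10: split `(0,1)` at `1/2`, fold by `x ↦ 1 − x`, one change of
variables `u = (1 − 2x)²`, merge the two copies). The shared item stmt-3727 is filed with the identical
body by the three routes CubicTransport, MellinCoarea and TwoRouteTransport; this file re-exports the
theorem under each route's name. No new mathematics.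
-/

namespace Summit.KontsevichZagierPeriods.CubicTransport

/-- **`DuplicationFamily`** (route CubicTransport, stmt-KontsevichZagierPeriods-3727): Legendre's
duplication `[(0,1), (x(1−x))^{a−1}] ∼ [(0,1), 2^{1−2a} x^{−1/2}(1−x)^{a−1}]` inside the KZ rules for
every rational `a > 0`. Proof: `InverseLandau.tateLifting_duplicationFamily`.
[cite: KontsevichZagier2001, §1.2] -/
theorem duplicationFamily_proof :
    Summit.KontsevichZagierPeriods.KontsevichZagierPeriods.Theses.CubicTransport.DuplicationFamily :=
  Summit.KontsevichZagierPeriods.InverseLandau.tateLifting_duplicationFamily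

end Summit.KontsevichZagierPeriods.CubicTransport

namespace Summit.KontsevichZagierPeriods.MellinCoarea

/-- **`DuplicationFamily`** (route MellinCoarea, verbatim twin of stmt-KontsevichZagierPeriods-3727):
Legendre's duplication inside the KZ rules. Proof: `InverseLandau.tateLifting_duplicationFamily`.
[cite: KontsevichZagier2001, §1.2] -/
theorem duplicationFamily_proof :
    Summit.KontsevichZagierPeriods.KontsevichZagierPeriods.Theses.MellinCoarea.DuplicationFamily :=
  Summit.KontsevichZagierPeriods.InverseLandau.tateLifting_duplicationFamily

end Summit.KontsevichZagierPeriods.MellinCoarea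

namespace Summit.KontsevichZagierPeriods.TwoRouteTransport

/-- **`DuplicationFamily`** (route TwoRouteTransport, verbatim twin of stmt-KontsevichZagierPeriods-3727):
Legendre's duplication inside the KZ rules. Proof: `InverseLandau.tateLifting_duplicationFamily`.
[cite: KontsevichZagier2001, §1.2] -/
theorem duplicationFamily_proof :
    Summit.KontsevichZagierPeriods.KontsevichZagierPeriods.Theses.TwoRouteTransport.DuplicationFamily :=
  Summit.KontsevichZagierPeriods.InverseLandau.tateLifting_duplicationFamily

end Summit.KontsevichZagierPeriods.TwoRouteTransport
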